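import Summits.ABC.IUTFork.Cor312ProvK
import Literature.IUT.LogVolume.Corollary22TwoAdicIntegrality
import HarnessLib

/-!
# [IUTchIII] Cor. 3.12 — a CONCRETE pilot datum on the INHABITED side of the tame depth dichotomy, part 1 (the datum):
# `F = ℚ(⁵√7)`, `j_E = 7⁻²`, `S = V(F)₇`, `l = 5`

Definition-bearing instance file of the abc-iut cell (block C / W6 cone prover abc-iut-w6-d114, gen 4; row
«LICENCE-SHALLOW-CONCRETE-DATUM», the glue step (3) of abc-iut-w4-d094's 2026-08-26T10:18:50Z map; pattern of
abc-iut-c312-14's `Cor312TameQuadInstance`). TAKES NO SIDE on [IUTchIII] Cor. 3.12 or on any author. The compositions with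
abc-iut-w5-d236's pilot-degree form `Cor312LicenceShallowRealising` (p439445) live in the proof-only sequel
`Cor312LicenceShallowConcreteDatumLicence`.

abc-iut-w5-d236's `exists_qPinned_and_hull_settingPrVolSharp_of_realises_shallow` says: at the sharp real settings,
for ideles REALISING `P_Θ`, `P_q`, branch C's antecedent «`∃ ρ qK, QPinned ∧ PilotKummerCompatHull`» (and the (xi-f)
`Licence`) holds as soon as EVERY bad place `v ∈ S` is TAME (`p_v > 2`, `e_v ≤ p_v − 2`) with `1 ≤ P_q(v)` and
`(l⋇)²·P_q(v) < e_v + 1` (binders `htame`, `hdeg`). That file is generic; the tree so far carried a concrete number field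
only on the REFUTED side (`F = ℚ`, `Cor312LicenceSharpRat`). THIS FILE builds a concrete datum on the INHABITED side and
discharges both arithmetic binders in kernel:

* §1 `F75 := ℚ(⁵√7) ⊆ ℝ` — `X⁵ − 7` is irreducible over `ℚ` (`7` is not a rational fifth power: `5 ∤ ord₇(7) = 1`),
  so `[F75 : ℚ] = 5`; `⁵√7` is an algebraic integer `rO` with `rO⁵ = 7`.
* §2 EVERY place `v ∣ 7` of `F75` has `p_v = 7`, **`e_v = 5`, `f_v = 1`**, and there is exactly one — with no
  Kummer–Dedekind computation: `⁵√7 ∈ v` (prime ideal containing `7 = (⁵√7)⁵`), so `e_v = ord_v(7) = 5·ord_v(⁵√7) ≥ 5`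
  (`Cor22.ord_natCast_eq_ramIdx`), while `e_v f_v ≤ Σ_{w ∣ 7} e_w f_w = [F75 : ℚ] = 5` (`sum_localDegree`). Hence `v` is
  TAME: `2 < 7`, `5 ≤ 7 − 2`.
* §3 the pilot datum `X75 : PilotData F75 := ⟨j_E := 7⁻², S := V(F75)₇, l := 5⟩` (`ord_v(j_E) = −10 < 0`):
  `ord_v(q_v) = 10 = 2l`, so abc-iut-c312-3's divisibility `Cor312Prov.TwoMulLDvdOrdq X75` HOLDS (realising Θ- and
  q-ideles EXIST, `Cor312Prov.exists_realising_{q,theta}Ideles_of_twoMulLDvdOrdq`); `P_q(v) = 1`, `l⋇ = 2`, so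
  **`htame_X75`, `hdeg_X75`** (`4·1 < 5 + 1`); `deĝ(P_q) = ln 7`, `deĝ̲(P_q) = |log(q)| = (ln 7)/5`.

READING (neutral; numbers, not adjectives). PilotData level ONLY: whether GENUINE initial Θ-data (K-level provenance,
abc-iut-C-cert-3 v5K: `K ⊇ F(E[l])`, `l ∣ e(w|v)`) realise such a datum is NOT claimed. The number theory here is
[folklore] ([cite: NeukirchANT1999, Ch. I §8 Prop. (8.2)] for `Σ e f = n`); [cite: DupuyHilado2025, §2.5.4, §3.3, §3.4];
[cite: Mochizuki2012, IUTchI Ex. 3.2 (iv) p. 71] for `2l ∣ ord_v(q_v)`; [claim: Mochizuki2012, status: disputed] for every IUT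
sentence quoted. typed ≠ proved; instantiated ≠ endorsed.
-/

noncomputable section

/-! ## §1. The field `F75 = ℚ(⁵√7)` -/

namespace Summit.ABC.IUTFork.ConcreteDatum

open Polynomial IntermediateField NumberField IsDedekindDomain
open Literature.IUT.LogVolume

/-- `⁵√7 ∈ ℝ`. [folklore] -/
def rt : ℝ := (7 : ℝ) ^ ((1 : ℝ) / 5)

/-- `⁵√7 > 0`. [folklore] -/
theorem rt_pos : 0 < rt := Real.rpow_pos_of_pos (by norm_num) _

/-- `(⁵√7)⁵ = 7`. [folklore] -/
theorem rt_pow : rt ^ 5 = 7 := by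
  rw [rt, ← Real.rpow_natCast, ← Real.rpow_mul (by norm_num : (0 : ℝ) ≤ 7)]
  norm_num

/-- `7` is not the fifth power of a rational (`ord₇`: `5·ord₇(b) = 1` is impossible). [folklore] -/
theorem pow_five_ne_seven (b : ℚ) : b ^ 5 ≠ 7 := by
  intro hb
  haveI : Fact (Nat.Prime 7) := ⟨by norm_num⟩
  have h := congrArg (padicValRat 7) hb
  rw [padicValRat.pow] at h
  have h7 : padicValRat 7 (7 : ℚ) = 1 := by exact_mod_cast padicValRat.self (p := 7) (by norm_num)
  rw [h7] at h
  push_cast at h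
  omega

/-- `X⁵ − 7` is irreducible over `ℚ`. [folklore] -/
theorem irreducible_X_pow_five_sub_seven : Irreducible (X ^ 5 - C (7 : ℚ)) :=
  X_pow_sub_C_irreducible_of_prime (by norm_num : Nat.Prime 5) fun b => pow_five_ne_seven b

/-- `⁵√7` is integral over `ℚ`. [folklore] -/
theorem rt_isIntegral_rat : IsIntegral ℚ rt := by
  refine ⟨X ^ 5 - C (7 : ℚ), monic_X_pow_sub_C _ (by norm_num), ?_⟩
  simp [rt_pow]

/-- The minimal polynomial of `⁵√7` over `ℚ` is `X⁵ − 7`. [folklore] -/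
theorem minpoly_rt : minpoly ℚ rt = X ^ 5 - C (7 : ℚ) := by
  refine (minpoly.eq_of_irreducible_of_monic irreducible_X_pow_five_sub_seven ?_
    (monic_X_pow_sub_C _ (by norm_num))).symm
  simp [rt_pow]

/-- **The field `F75 = ℚ(⁵√7)`** (as an intermediate field of `ℝ`). [folklore] -/
def F75 : IntermediateField ℚ ℝ := ℚ⟮rt⟯

/-- `F75` is finite over `ℚ`. [folklore] -/
instance : FiniteDimensional ℚ F75 :=
  IntermediateField.adjoin.finiteDimensional rt_isIntegral_rat

/-- `F75` is a number field. [folklore] -/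
instance : NumberField ↥F75 where

/-- `[F75 : ℚ] = 5`. [folklore] -/
theorem finrank_F75 : Module.finrank ℚ ↥F75 = 5 := by
  show Module.finrank ℚ ↥(ℚ⟮rt⟯) = 5
  rw [IntermediateField.adjoin.finrank rt_isIntegral_rat, minpoly_rt]
  compute_degree!

/-- `⁵√7` as an element of `F75`. [folklore] -/
def r : ↥F75 := AdjoinSimple.gen ℚ rt

/-- `r` maps to `⁵√7` in `ℝ`. [folklore] -/
theorem coe_r : (r : ℝ) = rt := rfl

/-- `r⁵ = 7`. [folklore] -/
theorem r_pow : r ^ 5 = 7 := by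
  have h : ((r ^ 5 : ↥F75) : ℝ) = ((7 : ↥F75) : ℝ) := by
    push_cast [coe_r]
    exact_mod_cast rt_pow
  exact_mod_cast h

/-- `r ≠ 0`. [folklore] -/
theorem r_ne_zero : r ≠ 0 := by
  intro h
  have : (r : ℝ) = 0 := by rw [h]; rfl
  rw [coe_r] at this
  exact absurd this (ne_of_gt rt_pos)

/-- `r` is integral over `ℤ`. [folklore] -/
theorem r_isIntegral : IsIntegral ℤ r := by
  refine ⟨X ^ 5 - C (7 : ℤ), monic_X_pow_sub_C _ (by norm_num), ?_⟩
  have := r_pow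
  simp only [eval₂_sub, eval₂_X_pow, eval₂_C]
  rw [show ((algebraMap ℤ ↥F75) 7) = (7 : ↥F75) from map_ofNat _ 7, this]
  ring

/-- `⁵√7` as an algebraic integer of `F75`. [folklore] -/
def rO : 𝓞 ↥F75 := ⟨r, r_isIntegral⟩

/-- `rO` maps to `r`. [folklore] -/
theorem algebraMap_rO : algebraMap (𝓞 ↥F75) ↥F75 rO = r := rfl

/-- `rO ≠ 0`. [folklore] -/
theorem rO_ne_zero : rO ≠ 0 := by
  intro h
  apply r_ne_zero
  rw [← algebraMap_rO, h, map_zero]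

/-- `rO⁵ = 7` in `𝒪_{F75}`. [folklore] -/
theorem rO_pow : rO ^ 5 = 7 := by
  apply RingOfIntegers.coe_injective
  show algebraMap (𝓞 ↥F75) ↥F75 (rO ^ 5) = algebraMap (𝓞 ↥F75) ↥F75 7
  rw [map_pow, algebraMap_rO, r_pow, map_ofNat]

/-! ## §2. Every place over `7` is totally ramified (`e = 5`), hence tame -/

/-- `7` is prime (instance for `placesOver F75 7`). [folklore] -/
instance fact_prime_seven : Fact (Nat.Prime 7) := ⟨by norm_num⟩

/-- A place of `F75` over `7` contains `7`. [folklore] -/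
theorem seven_mem_of_mem_placesOver {v : HeightOneSpectrum (𝓞 ↥F75)} (hv : v ∈ placesOver ↥F75 7) :
    ((7 : ℕ) : 𝓞 ↥F75) ∈ v.asIdeal := by
  have h := (mem_placesOver_iff v).mp hv
  have hmem : ((7 : ℕ) : ℤ) ∈ v.asIdeal.under ℤ := by
    rw [← h.over]; exact Ideal.mem_span_singleton_self _
  simpa using Ideal.mem_comap.mp hmem

/-- A place of `F75` over `7` contains `⁵√7` (prime ideal containing `(⁵√7)⁵ = 7`). [folklore] -/
theorem rO_mem_of_mem_placesOver {v : HeightOneSpectrum (𝓞 ↥F75)} (hv : v ∈ placesOver ↥F75 7) :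
    rO ∈ v.asIdeal := by
  have h7 : rO ^ 5 ∈ v.asIdeal := by
    rw [rO_pow]
    exact_mod_cast seven_mem_of_mem_placesOver hv
  exact v.isPrime.mem_of_pow_mem 5 h7

/-- The residue characteristic of a place of `F75` over `7` is `7`. [folklore] -/
theorem residueChar_of_mem_placesOver {v : HeightOneSpectrum (𝓞 ↥F75)} (hv : v ∈ placesOver ↥F75 7) :
    residueChar ↥F75 v = 7 :=
  (mem_placesOver_iff_residueChar v).mp hv

/-- **`e_v ≥ 5`** at a place over `7`: `e_v = ord_v(7) = ord_v((⁵√7)⁵) = 5·ord_v(⁵√7)` with `ord_v(⁵√7) ≥ 1`.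
[folklore] -/
theorem five_le_ramIdx_of_mem_placesOver {v : HeightOneSpectrum (𝓞 ↥F75)} (hv : v ∈ placesOver ↥F75 7) :
    5 ≤ ramIdx ↥F75 v := by
  have h7 : ord ↥F75 v ((7 : ℕ) : ↥F75) = ramIdx ↥F75 v := Cor22.ord_natCast_eq_ramIdx 7 v hv
  have hr : ((7 : ℕ) : ↥F75) = (r : ↥F75) ^ 5 := by
    push_cast
    exact r_pow.symm
  rw [hr, ord_pow] at h7
  have hpos : 0 < ord ↥F75 v (r : ↥F75) := by
    rw [← algebraMap_rO]
    exact (ord_pos_iff_mem (↥F75) v rO rO_ne_zero).mpr (rO_mem_of_mem_placesOver hv)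
  push_cast at h7
  have h5 : (5 : ℤ) ≤ (ramIdx ↥F75 v : ℤ) := by
    rw [← h7]
    linarith
  exact_mod_cast h5

/-- **`e_v ≤ 5`** at a place over `7`: `e_v ≤ e_v·f_v ≤ Σ_{w ∣ 7} e_w f_w = [F75 : ℚ] = 5`.
[cite: NeukirchANT1999, Ch. I §8 Prop. (8.2)] -/
theorem ramIdx_le_five_of_mem_placesOver {v : HeightOneSpectrum (𝓞 ↥F75)} (hv : v ∈ placesOver ↥F75 7) :
    ramIdx ↥F75 v ≤ 5 := by
  have hsum : ∑ w ∈ placesOver ↥F75 7, localDegree ↥F75 w = 5 := by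
    rw [sum_localDegree, finrank_F75]
  have hle : localDegree ↥F75 v ≤ ∑ w ∈ placesOver ↥F75 7, localDegree ↥F75 w :=
    Finset.single_le_sum (fun w _ => Nat.zero_le (localDegree ↥F75 w)) hv
  have hef : ramIdx ↥F75 v ≤ localDegree ↥F75 v := by
    unfold localDegree
    exact Nat.le_mul_of_pos_right _ (Nat.pos_of_ne_zero (resDeg_ne_zero ↥F75 v))
  omega

/-- **`e_v = 5`**: every place of `ℚ(⁵√7)` over `7` is totally ramified. [folklore] -/
theorem ramIdx_of_mem_placesOver {v : HeightOneSpectrum (𝓞 ↥F75)} (hv : v ∈ placesOver ↥F75 7) :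
    ramIdx ↥F75 v = 5 :=
  le_antisymm (ramIdx_le_five_of_mem_placesOver hv) (five_le_ramIdx_of_mem_placesOver hv)

/-- **Tameness**: a place of `F75` over `7` has `p_v = 7 > 2` and `e_v = 5 ≤ 7 − 2`. [folklore] -/
theorem tame_of_mem_placesOver {v : HeightOneSpectrum (𝓞 ↥F75)} (hv : v ∈ placesOver ↥F75 7) :
    2 < residueChar ↥F75 v ∧ ramIdx ↥F75 v ≤ residueChar ↥F75 v - 2 := by
  rw [residueChar_of_mem_placesOver hv, ramIdx_of_mem_placesOver hv]
  norm_num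

/-- **`f_v = 1`** at a place over `7` (`e_v f_v ≤ 5 = e_v`). [cite: NeukirchANT1999, Ch. I §8 Prop. (8.2)] -/
theorem resDeg_of_mem_placesOver {v : HeightOneSpectrum (𝓞 ↥F75)} (hv : v ∈ placesOver ↥F75 7) :
    resDeg ↥F75 v = 1 := by
  have hsum : ∑ w ∈ placesOver ↥F75 7, localDegree ↥F75 w = 5 := by
    rw [sum_localDegree, finrank_F75]
  have hle : localDegree ↥F75 v ≤ ∑ w ∈ placesOver ↥F75 7, localDegree ↥F75 w :=
    Finset.single_le_sum (fun w _ => Nat.zero_le (localDegree ↥F75 w)) hv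
  have hf0 : resDeg ↥F75 v ≠ 0 := resDeg_ne_zero ↥F75 v
  have hloc : localDegree ↥F75 v = 5 * resDeg ↥F75 v := by
    unfold localDegree
    rw [ramIdx_of_mem_placesOver hv]
  omega

/-- **`n_v = e_v f_v = 5`** at a place over `7`. [cite: NeukirchANT1999, Ch. I §8 Prop. (8.2)] -/
theorem localDegree_of_mem_placesOver {v : HeightOneSpectrum (𝓞 ↥F75)} (hv : v ∈ placesOver ↥F75 7) :
    localDegree ↥F75 v = 5 := by
  unfold localDegree
  rw [ramIdx_of_mem_placesOver hv, resDeg_of_mem_placesOver hv]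

/-- **There is exactly ONE place of `ℚ(⁵√7)` over `7`** (`Σ_{w ∣ 7} n_w = 5` with every `n_w = 5`). [folklore] -/
theorem card_placesOver_seven : (placesOver ↥F75 7).card = 1 := by
  have hsum : ∑ w ∈ placesOver ↥F75 7, localDegree ↥F75 w = 5 := by
    rw [sum_localDegree, finrank_F75]
  have hle : (placesOver ↥F75 7).card • 5 ≤ ∑ w ∈ placesOver ↥F75 7, localDegree ↥F75 w :=
    Finset.card_nsmul_le_sum _ _ _ fun w hw => (localDegree_of_mem_placesOver hw).ge
  have hpos : 0 < (placesOver ↥F75 7).card := Finset.card_pos.mpr (placesOver_nonempty ↥F75 7)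
  rw [hsum, smul_eq_mul] at hle
  omega

/-- `ln|κ(v)| = ln 7` at a place over `7` (`f_v = 1`). [cite: DupuyHilado2025, §2.5.4] -/
theorem logNorm_of_mem_placesOver {v : HeightOneSpectrum (𝓞 ↥F75)} (hv : v ∈ placesOver ↥F75 7) :
    logNorm ↥F75 v = Real.log 7 := by
  rw [logNorm_eq, resDeg_of_mem_placesOver hv, residueChar_of_mem_placesOver hv]
  push_cast
  ring

/-! ## §3. The pilot datum `X75 = (F75, j_E = 7⁻², S = V(F75)₇, l = 5)` -/

/-- `ord_v(7⁻²) = −10` at a place over `7`. [folklore] -/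
theorem ord_jE_of_mem_placesOver {v : HeightOneSpectrum (𝓞 ↥F75)} (hv : v ∈ placesOver ↥F75 7) :
    ord ↥F75 v (((7 : ↥F75)⁻¹) ^ 2) = -10 := by
  have h7 : ord ↥F75 v ((7 : ℕ) : ↥F75) = ramIdx ↥F75 v := Cor22.ord_natCast_eq_ramIdx 7 v hv
  rw [ramIdx_of_mem_placesOver hv] at h7
  push_cast at h7
  rw [ord_pow, ord_inv, h7]
  norm_num

/-- **The concrete pilot datum `X75`**: `F = ℚ(⁵√7)`, `j_E = 7⁻²` (so `ord_v(j_E) = −10 < 0` at `v ∣ 7`), `S = V(F)₇`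
(all places over `7`; there is exactly one, but only `e_v = 5` for each is used), `l = 5`.
[cite: DupuyHilado2025, §3.3] -/
def X75 : PilotData ↥F75 where
  jE := ((7 : ↥F75)⁻¹) ^ 2
  S := placesOver ↥F75 7
  S_nonempty := placesOver_nonempty ↥F75 7
  ord_jE_neg v hv := by
    rw [ord_jE_of_mem_placesOver hv]
    norm_num
  l := 5
  l_prime := by norm_num
  five_le_l := le_rfl

/-- `X75.S = V(F75)₇`. [cite: DupuyHilado2025, §3.3] -/
theorem X75_S : X75.S = placesOver ↥F75 7 := rfl

/-- `X75.l = 5`. [cite: DupuyHilado2025, §3.3] -/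
theorem X75_l : X75.l = 5 := rfl

/-- `l⋇ = 2` for `X75`. [cite: DupuyHilado2025, §3.3] -/
theorem X75_lstar : X75.lstar = 2 := rfl

/-- `ord_v(q_v) = 10` at every bad place of `X75`. [cite: DupuyHilado2025, §3.2–3.3] -/
theorem X75_ordq {v : HeightOneSpectrum (𝓞 ↥F75)} (hv : v ∈ X75.S) : X75.ordq v = 10 := by
  unfold PilotData.ordq
  rw [show X75.jE = ((7 : ↥F75)⁻¹) ^ 2 from rfl, ord_jE_of_mem_placesOver hv]
  norm_num

/-- **`2l ∣ ord_v(q_v)` on `S`** (`10 ∣ 10`): abc-iut-c312-3's divisibility hypothesis HOLDS at `X75`, so realising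
Θ- and q-ideles exist there. [cite: Mochizuki2012, IUTchI Ex. 3.2 (iv) p. 71] -/
theorem twoMulLDvdOrdq_X75 : Cor312Prov.TwoMulLDvdOrdq X75 := by
  intro w hw
  rw [X75_ordq hw, X75_l]
  norm_num

/-- `P_q(v) = 1` at every bad place of `X75` (`= ord_v(q_v)/(2l) = 10/10`). [cite: DupuyHilado2025, §3.3] -/
theorem X75_qPilot {v : HeightOneSpectrum (𝓞 ↥F75)} (hv : v ∈ X75.S) : X75.qPilot v = 1 := by
  rw [X75.qPilot_apply_of_mem hv, X75_ordq hv, X75_l]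
  norm_num

/-- **The tameness binder `htame` of abc-iut-w5-d236's theorem, DISCHARGED at `X75`.** [folklore] -/
theorem htame_X75 : ∀ v ∈ X75.S, 2 < residueChar ↥F75 v ∧ ramIdx ↥F75 v ≤ residueChar ↥F75 v - 2 :=
  fun _ hv => tame_of_mem_placesOver hv

/-- **The degree-locus binder `hdeg` of abc-iut-w5-d236's theorem, DISCHARGED at `X75`**: `1 ≤ P_q(v) = 1` and
`(l⋇)²·P_q(v) = 4 < e_v + 1 = 6`. [cite: DupuyHilado2025, §3.3–3.4] -/
theorem hdeg_X75 :
    ∀ v ∈ X75.S, 1 ≤ X75.qPilot v ∧ ((X75.lstar : ℕ) : ℝ) ^ 2 * X75.qPilot v < (ramIdx ↥F75 v : ℝ) + 1 := by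
  intro v hv
  rw [X75_qPilot hv, X75_lstar, ramIdx_of_mem_placesOver hv]
  norm_num

/-- **`deĝ(P_q) = ln 7`** for `X75` (`P_q = Σ_{v ∣ 7} 1·[v]`, one place with `ln|κ(v)| = ln 7`). [cite: DupuyHilado2025, §2.5.4, §3.3] -/
theorem deg_qPilot_X75 : FinDivisor.deg ↥F75 X75.qPilot = Real.log 7 := by
  rw [PilotData.qPilot, FinDivisor.deg_sum_of]
  have h : ∀ v ∈ X75.S, (X75.ordq v : ℝ) / (2 * X75.l) * logNorm ↥F75 v = Real.log 7 := by
    intro v hv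
    rw [X75_ordq hv, X75_l, logNorm_of_mem_placesOver hv]
    norm_num
  rw [Finset.sum_congr rfl h, Finset.sum_const, X75_S, card_placesOver_seven]
  simp

/-- **`deĝ̲(P_q) = |log(q)| = (ln 7)/5`** for `X75` (normalised degree, `[F75 : ℚ] = 5`). [cite: DupuyHilado2025, §2.5.4, §3.3] -/
theorem ndeg_qPilot_X75 : FinDivisor.ndeg ↥F75 X75.qPilot = Real.log 7 / 5 := by
  rw [FinDivisor.ndeg_apply, deg_qPilot_X75, finrank_F75]
  norm_num

end Summit.ABC.IUTFork.ConcreteDatum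

end
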